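import Summits.Ventures.CertifiedArithmetic.LowPrec.SRWindow
import Summits.Ventures.CertifiedArithmetic.LowPrec.SRBiasedEps
import HarnessLib

/-!
# Stochastic rounding in low-precision formats LX — mean-square error of recursive summation under
# LIMITED-RANDOMNESS stochastic rounding: `E(ŝₙ − sₙ)² ≤ n·g²/4 + (n·ε·g)²` (sharp), and where it breaks

HONEST FRAMING: certified error envelopes and provably optimal rounding/accumulation schemes for
low-precision formats under stated cost models; every table by two implementations; no hardware or
vendor claims.

Setting (files VII/XIX, `LowPrec/SRLimitedBits`): a saturating rounding step into a finite value set
`F` rounds AWAY from zero with probability `q(θ)`, `θ` the exact-SR away-probability, `q : [0,1] → [0,1]`,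
`|q(θ) − θ| ≤ ε` — IEEE P3109 StochasticA/B/C with `N` random bits (`ε = 2^{-N}, 2^{-(N+1)}, 2^{-(N+1)}`),
the biased `SR_ε` of [XiaEtAl2022] (file LVIII), exact SR (`ε = 0`); `accExpQ F q x n f s = E f(ŝₙ)`,
`ŝ₀ = s`, `ŝₖ₊₁ = round(ŝₖ + xₖ)`.  File XIX: bias `|E ŝₙ − sₙ| ≤ n·ε·G`; here: the second moment.
1. `stepQ_sq_le`: `E(round(c) − c)² ≤ (⌈c⌉ − ⌊c⌋)²·(1/4 + ε²)`.
2. `accExpQ_sq_le_uniform`: if `F ∩ [lo, hi]` is equally spaced with spacing `g` (`UniformWindow`: two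
   finitely checkable clauses), `0 ≤ lo`, no branch saturates and every pre-rounding value lies in
   `[lo, hi]`, then `E(ŝₙ − sₙ)² ≤ n·g²/4 + (n·ε·g)²` — exact-SR variance budget plus worst-case bias
   SQUARED, no cross term — for EVERY admissible `q` (`srEps_acc_sq_le`, `stochasticA/B/C_acc_sq_le`).
   Mechanism (`UniformWindow.accExpQ_shift`): translation by one ulp conjugates the outcome tree, so the
   bias-to-go is the same from both rounding candidates and the noise–bias correlation vanishes
   identically; the per-step excess `ε²g²` of item 1 completes the square `((n+1)εg)² = (nεg)² +
   2(nεg)(εg) + (εg)²`.  ATTAINED: `FP4.e2m1_mse_tight` (E2M1, `SR_ε`, `ε = 1/4`, two additions, `3/16`).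
3. `bias_sq_le_var_iff`: bias term `≤` variance term iff `n·ε² ≤ 1/4` (with `N` bits: iff `n ≤ 4^{N−1}`)
   — the rule of thumb `r ≈ ⌈log₂ n⌉/2` of [ElararEtAl2025, Remark 8] as an exact statement here.
4. WHERE IT BREAKS (`FP4.e2m1_mse_cross_zero`): the sign hypothesis is NECESSARY for rules whose bias
   follows the sign (all of the above): E2M1, `SR_ε`, `ε = 1/8`, `0 − 5/4 + 5/4` (inside the equally
   spaced `[−2, 2]`, across `0`): `E(ŝ₂ − s₂)² = 5/32 > 9/64 = 2g²/4 + (2εg)²` — across zero the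
   bias-to-go differs between the branches (`±εg`) and correlates with the rounding noise.  Binade
   crossings (`G` = largest gap met) are NOT claimed: exhaustive enumeration (E2M1, `n ≤ 3`, `1/4`-grid)
   found no violation of `n·G²/4 + (nεG)²` (max ratio `41/42`; sr seat certificates gen12/mse).
Prior art: [ElararEtAl2025, Thm. 3–4]: relative error of recursive summation under the truncation rule
`SR_{p,r}` is `≲ √n·u_p` (martingale/Chebyshev, probability `1 − λ`) `+ n·u_{p+r}`, first-order model.
Here: exact second-moment inequalities on any finite value set for every `q` within `ε` of exact SR,
the hypothesis killing the cross term explicit, sharpness and necessity by kernel-checked instances.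
-/


namespace Summit.Ventures.CertifiedArithmetic.LowPrec.SR

open Literature.ComputerArithmetic.ConnollyHighamMary2021
open Finset

variable {K : Type*} [Field K] [LinearOrder K] [IsStrictOrderedRing K]

namespace LimitedBits

omit [IsStrictOrderedRing K] in
/-- Linearity: `E[a·f(ŝₙ) + b·h(ŝₙ)] = a·E f(ŝₙ) + b·E h(ŝₙ)`. -/
theorem accExpQ_lin (F : Finset K) (q : K → K) : ∀ (x : ℕ → K) (n : ℕ) (a b : K) (f h : K → K) (s : K),
    accExpQ F q x n (fun t => a * f t + b * h t) s = a * accExpQ F q x n f s + b * accExpQ F q x n h s := by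
  intro x n
  induction n generalizing x with
  | zero => intro a b f h s; rfl
  | succ n ih =>
    intro a b f h s
    show stepQ F q (s + x 0) (accExpQ F q (fun i => x (i + 1)) n (fun t => a * f t + b * h t))
      = a * stepQ F q (s + x 0) (accExpQ F q (fun i => x (i + 1)) n f)
        + b * stepQ F q (s + x 0) (accExpQ F q (fun i => x (i + 1)) n h)
    have : accExpQ F q (fun i => x (i + 1)) n (fun t => a * f t + b * h t) = fun t =>
        a * accExpQ F q (fun i => x (i + 1)) n f t + b * accExpQ F q (fun i => x (i + 1)) n h t :=
      funext fun t => ih _ a b f h t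
    rw [this]; unfold stepQ; ring

omit [IsStrictOrderedRing K] in
/-- `E[1] = 1`. -/
theorem accExpQ_one (F : Finset K) (q : K → K) :
    ∀ (x : ℕ → K) (n : ℕ) (s : K), accExpQ F q x n (fun _ => (1 : K)) s = 1 := by
  intro x n
  induction n generalizing x with
  | zero => intro s; rfl
  | succ n ih =>
    intro s
    show stepQ F q (s + x 0) (accExpQ F q (fun i => x (i + 1)) n (fun _ => 1)) = _
    have : accExpQ F q (fun i => x (i + 1)) n (fun _ => (1 : K)) = fun _ => 1 := funext fun t => ih _ t
    rw [this, stepQ_const]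

omit [IsStrictOrderedRing K] in
/-- Splitting the squared error about `c + S` at a branch point `t`:
`E(ŝ − (c+S))² = E(ŝ − (t+S))² + 2(t − c)·(E ŝ − (t+S)) + (t − c)²`. -/
theorem accExpQ_sq_split (F : Finset K) (q : K → K) (x : ℕ → K) (n : ℕ) (t S c : K) :
    accExpQ F q x n (fun y => (y - (c + S)) ^ 2) t
      = accExpQ F q x n (fun y => (y - (t + S)) ^ 2) t
        + 2 * (t - c) * (accExpQ F q x n (fun y => y) t - (t + S)) + (t - c) ^ 2 := by
  have h1 : (fun y : K => (y - (c + S)) ^ 2) = fun y =>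
      1 * (y - (t + S)) ^ 2 + 1 * ((2 * (t - c)) * y + ((t - c) ^ 2 - 2 * (t - c) * (t + S)) * 1) := by
    funext y; ring
  rw [h1, accExpQ_lin, accExpQ_lin, accExpQ_one]; ring

omit [IsStrictOrderedRing K] in
/-- `E[ŝₙ + a] = E ŝₙ + a`. -/
theorem accExpQ_id_add (F : Finset K) (q : K → K) (x : ℕ → K) (n : ℕ) (a t : K) :
    accExpQ F q x n (fun y => y + a) t = accExpQ F q x n (fun y => y) t + a := by
  rw [show (fun y : K => y + a) = fun y => 1 * y + a * 1 from funext fun y => by ring, accExpQ_lin,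
    accExpQ_one]; ring

/-- **Per-step mean-square error** at an in-hull point: `E(round(c) − c)² ≤ (⌈c⌉ − ⌊c⌋)²(1/4 + ε²)`. -/
theorem stepQ_sq_le (F : Finset K) {q : K → K} {ε : K}
    (hq : ∀ η, 0 ≤ η → η ≤ 1 → |q η - η| ≤ ε) {c : K} (hc : InHull F c) :
    stepQ F q c (fun z => (z - c) ^ 2) ≤ (up F c - dn F c) ^ 2 * (1 / 4 + ε ^ 2) := by
  rw [stepQ_sq_eq_frontier F q hc, srVar_eq_dn_up hc]
  have hβ := abs_stepQ_id_sub_le F hq c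
  rw [clamp_eq_self hc] at hβ
  have hβ2 := sq_le_sq' (abs_le.mp hβ).1 (abs_le.mp hβ).2
  nlinarith [sq_nonneg (dn F c + up F c - 2 * c - 2 * (stepQ F q c (fun t => t) - c))]

/-- `UniformWindow F lo hi g`: `F ∩ [lo, hi] = {lo, lo + g, …, hi}`, as the two finitely checkable
clauses used: every value `< hi` has successor `a + g ∈ F`; two values of the window differ by `≥ g`. -/
structure UniformWindow (F : Finset K) (lo hi g : K) : Prop where
  lo_mem : lo ∈ F
  hi_mem : hi ∈ F
  pos : 0 < g
  succ_mem : ∀ a ∈ F, lo ≤ a → a < hi → a + g ∈ F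
  sep : ∀ a ∈ F, ∀ b ∈ F, lo ≤ a → b ≤ hi → a < b → a + g ≤ b

namespace UniformWindow

variable {F : Finset K} {lo hi g : K}

omit [IsStrictOrderedRing K] in
/-- Points of the window are in the hull. -/
theorem inHull (hU : UniformWindow F lo hi g) {c : K} (h1 : lo ≤ c) (h2 : c ≤ hi) : InHull F c :=
  ⟨⟨lo, hU.lo_mem, h1⟩, ⟨hi, hU.hi_mem, h2⟩⟩

/-- Translation of the lower candidate: `⌊c + g⌋ = ⌊c⌋ + g`. -/
theorem roundDown_shift (hU : UniformWindow F lo hi g) {c : K} (h1 : lo ≤ c) (h2 : c + g ≤ hi) :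
    roundDown F (c + g) = roundDown F c + g := by
  have hd : roundDown F c ∈ F := roundDown_mem ⟨lo, hU.lo_mem, h1⟩
  have hld : lo ≤ roundDown F c := le_roundDown_of_mem hU.lo_mem h1
  have hdc : roundDown F c ≤ c := roundDown_le F c
  have hdg : roundDown F c + g ∈ F := hU.succ_mem _ hd hld (by linarith [hU.pos])
  refine le_antisymm (not_lt.mp fun hlt' => ?_) (le_roundDown_of_mem hdg (by linarith))
  have hd' : roundDown F (c + g) ∈ F := roundDown_mem ⟨_, hdg, by linarith⟩
  have h2g := hU.sep _ hdg _ hd' (by linarith [hU.pos]) ((roundDown_le F _).trans h2) hlt'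
  have : roundDown F c + g ≤ roundDown F c :=
    le_roundDown_of_mem hdg (by linarith [roundDown_le F (c + g)])
  linarith [hU.pos]

/-- Off the grid a cell has width exactly `g`: `⌈c⌉ = ⌊c⌋` or `⌈c⌉ = ⌊c⌋ + g`. -/
theorem roundUp_eq_or (hU : UniformWindow F lo hi g) {c : K} (h1 : lo ≤ c) (h2 : c ≤ hi) :
    roundUp F c = roundDown F c ∨ roundUp F c = roundDown F c + g := by
  have hd : roundDown F c ∈ F := roundDown_mem ⟨lo, hU.lo_mem, h1⟩
  have hu : roundUp F c ∈ F := roundUp_mem ⟨hi, hU.hi_mem, h2⟩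
  have hld : lo ≤ roundDown F c := le_roundDown_of_mem hU.lo_mem h1
  have huh : roundUp F c ≤ hi := roundUp_le_of_mem hU.hi_mem h2
  rcases eq_or_lt_of_le (roundDown_le_roundUp F c) with h | h
  · exact Or.inl h.symm
  right
  have hdg : roundDown F c + g ∈ F := hU.succ_mem _ hd hld (lt_of_lt_of_le h huh)
  have hcdg : c ≤ roundDown F c + g := not_lt.mp fun hlt => by
    have := le_roundDown_of_mem hdg hlt.le; linarith [hU.pos]
  exact le_antisymm (roundUp_le_of_mem hdg hcdg) (hU.sep _ hd _ hu hld huh h)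

/-- Translation of the upper candidate: `⌈c + g⌉ = ⌈c⌉ + g`. -/
theorem roundUp_shift (hU : UniformWindow F lo hi g) {c : K} (h1 : lo ≤ c) (h2 : c + g ≤ hi) :
    roundUp F (c + g) = roundUp F c + g := by
  have hg := hU.pos
  have hds := hU.roundDown_shift h1 h2
  have hdm : roundDown F c ∈ F := roundDown_mem ⟨lo, hU.lo_mem, h1⟩
  rcases hU.roundUp_eq_or h1 (by linarith) with h | h
  · have hc : roundDown F c = c := eq_of_roundUp_eq_roundDown h
    have hcm : c + g ∈ F := by
      have := hU.succ_mem _ hdm (le_roundDown_of_mem hU.lo_mem h1) (by linarith)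
      rwa [hc] at this
    rw [roundUp_eq_self_of_mem hcm, h, hc]
  · rcases hU.roundUp_eq_or (c := c + g) (by linarith) h2 with h' | h'
    · exfalso
      have hcg : roundDown F (c + g) = c + g := eq_of_roundUp_eq_roundDown h'
      have hc : roundDown F c = c := by linarith
      have hcm : c ∈ F := by rw [← hc]; exact hdm
      have := roundUp_eq_self_of_mem hcm
      linarith
    · rw [h', hds, h]

/-- One limited-randomness step commutes with translation by one ulp (nonnegative window). -/
theorem stepQ_shift (hU : UniformWindow F lo hi g) (hlo : 0 ≤ lo) (q : K → K) {c : K} (h1 : lo ≤ c)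
    (h2 : c + g ≤ hi) (f : K → K) : stepQ F q (c + g) f = stepQ F q c (fun t => f (t + g)) := by
  have hg := hU.pos
  have hc : InHull F c := hU.inHull h1 (by linarith)
  have hcg : InHull F (c + g) := hU.inHull (by linarith) h2
  have hdn : dn F (c + g) = dn F c + g := by
    unfold dn; rw [clamp_eq_self hc, clamp_eq_self hcg]; exact hU.roundDown_shift h1 h2
  have hup : up F (c + g) = up F c + g := by
    unfold up; rw [clamp_eq_self hc, clamp_eq_self hcg]; exact hU.roundUp_shift h1 h2
  have hp : pUp F (c + g) = pUp F c := by
    unfold pUp probUp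
    rw [clamp_eq_self hc, clamp_eq_self hcg, hU.roundDown_shift h1 h2, hU.roundUp_shift h1 h2]
    ring_nf
  have hd0 : 0 ≤ dn F c := by
    unfold dn; rw [clamp_eq_self hc]; exact hlo.trans (le_roundDown_of_mem hU.lo_mem h1)
  have hd0' : 0 ≤ dn F (c + g) := by rw [hdn]; linarith
  unfold stepQ pUpQ
  rw [if_pos hd0, if_pos hd0', hp, hup, hdn]

/-- **Translation conjugates the outcome tree**: from `t + g` the n-step expectation of `f` equals,
from `t`, that of `f(· + g)` — for outcome trees from `t` and from `t + g` that do not saturate and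
keep every pre-rounding value in `[lo, hi]`. -/
theorem accExpQ_shift (hU : UniformWindow F lo hi g) (hlo : 0 ≤ lo) (q : K → K) :
    ∀ (x : ℕ → K) (n : ℕ) (f : K → K) (t : K), NoSat F x n t → InWindow F lo hi x n t →
      NoSat F x n (t + g) → InWindow F lo hi x n (t + g) →
      accExpQ F q x n f (t + g) = accExpQ F q x n (fun y => f (y + g)) t := by
  intro x n
  induction n generalizing x with
  | zero => intro f t _ _ _ _; rfl
  | succ n ih =>
    rintro f t ⟨hin, hnu, hnd⟩ ⟨⟨h1, h2⟩, hwu, hwd⟩ ⟨hin', hnu', hnd'⟩ ⟨⟨-, h2'⟩, hwu', hwd'⟩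
    have e : t + g + x 0 = (t + x 0) + g := by ring
    rw [clamp_eq_self hin] at h1 h2
    rw [e, clamp_eq_self (e ▸ hin')] at h2'
    have hc : InHull F (t + x 0) := hU.inHull h1 h2
    have hcg : InHull F (t + x 0 + g) := hU.inHull (by linarith [hU.pos]) h2'
    have hup : up F (t + x 0 + g) = up F (t + x 0) + g := by
      unfold up; rw [clamp_eq_self hc, clamp_eq_self hcg]; exact hU.roundUp_shift h1 h2'
    have hdn : dn F (t + x 0 + g) = dn F (t + x 0) + g := by
      unfold dn; rw [clamp_eq_self hc, clamp_eq_self hcg]; exact hU.roundDown_shift h1 h2'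
    rw [e, hup] at hnu' hwu'
    rw [e, hdn] at hnd' hwd'
    show stepQ F q (t + g + x 0) (accExpQ F q (fun i => x (i + 1)) n f)
      = stepQ F q (t + x 0) (accExpQ F q (fun i => x (i + 1)) n (fun y => f (y + g)))
    rw [e, hU.stepQ_shift hlo q h1 h2']
    simp only [stepQ]
    rw [ih _ f _ hnu hwu hnu' hwu', ih _ f _ hnd hwd hnd' hwd']

/-- On a uniform window every candidate gap met is `≤ g`. -/
theorem gapLE (hU : UniformWindow F lo hi g) :
    ∀ (x : ℕ → K) (n : ℕ) (s : K), InWindow F lo hi x n s → GapLE F g x n s := by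
  intro x n
  induction n generalizing x with
  | zero => intro s _; trivial
  | succ n ih =>
    rintro s ⟨⟨h1, h2⟩, hwu, hwd⟩
    refine ⟨?_, ih _ _ hwu, ih _ _ hwd⟩
    rcases hU.roundUp_eq_or h1 h2 with h | h
    · rw [h, sub_self]; exact hU.pos.le
    · rw [h]; linarith

end UniformWindow

set_option maxHeartbeats 800000 in
/-- **MSE of recursive summation under limited-randomness SR, uniform one-signed window**: if
`q : [0,1] → [0,1]`, `|q − id| ≤ ε`, `F ∩ [lo, hi]` is uniformly spaced with spacing `g`, `0 ≤ lo`, no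
branch saturates and every pre-rounding value lies in `[lo, hi]`, then
`E(ŝₙ − (s + ∑ xₖ))² ≤ n·g²/4 + (n·ε·g)²`.  Sharp (`FP4.e2m1_mse_tight`); the sign hypothesis is
necessary (`FP4.e2m1_mse_cross_zero`). -/
theorem accExpQ_sq_le_uniform (F : Finset K) {q : K → K} {ε lo hi g : K}
    (hq01 : ∀ η, 0 ≤ η → η ≤ 1 → 0 ≤ q η ∧ q η ≤ 1) (hq : ∀ η, 0 ≤ η → η ≤ 1 → |q η - η| ≤ ε)
    (hU : UniformWindow F lo hi g) (hlo : 0 ≤ lo) :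
    ∀ (x : ℕ → K) (n : ℕ) (s : K), NoSat F x n s → InWindow F lo hi x n s →
      accExpQ F q x n (fun t => (t - (s + ∑ i ∈ range n, x i)) ^ 2) s
        ≤ n * (g ^ 2 / 4) + (n * (ε * g)) ^ 2 := by
  have hεg : 0 ≤ ε * g := mul_nonneg ((abs_nonneg _).trans (hq 0 le_rfl zero_le_one)) hU.pos.le
  intro x n
  induction n generalizing x with
  | zero => intro s _ _; simp [accExpQ]
  | succ n ih =>
    rintro s ⟨hin, hnu, hnd⟩ ⟨⟨h1, h2⟩, hwu, hwd⟩
    have hsum : s + ∑ i ∈ range (n + 1), x i = (s + x 0) + ∑ i ∈ range n, x (i + 1) := by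
      rw [Finset.sum_range_succ']; ring
    simp only [hsum]
    show stepQ F q (s + x 0) (accExpQ F q (fun i => x (i + 1)) n
      (fun t => (t - ((s + x 0) + ∑ i ∈ range n, x (i + 1))) ^ 2)) ≤ _
    have hcl : clamp F (s + x 0) = s + x 0 := clamp_eq_self hin
    rw [hcl] at h1 h2
    have hnεg : 0 ≤ (n : K) * (ε * g) := mul_nonneg (Nat.cast_nonneg n) hεg
    have hfin : (n : K) * (g ^ 2 / 4) + (n * (ε * g)) ^ 2 + 2 * ((n * (ε * g)) * (ε * g))
        + g ^ 2 * (1 / 4 + ε ^ 2) = (↑(n + 1) : K) * (g ^ 2 / 4) + (↑(n + 1) * (ε * g)) ^ 2 := by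
      push_cast; ring
    have hmono : (n : K) * (g ^ 2 / 4) + (n * (ε * g)) ^ 2
        ≤ (↑(n + 1) : K) * (g ^ 2 / 4) + (↑(n + 1) * (ε * g)) ^ 2 := by
      have : 0 ≤ g ^ 2 * (1 / 4 + ε ^ 2) := by positivity
      linarith [mul_nonneg hnεg hεg]
    set c := s + x 0 with hc
    set x' : ℕ → K := fun i => x (i + 1) with hx'
    set S' : K := ∑ i ∈ range n, x' i with hS'
    have hMu := ih x' (up F c) hnu hwu
    have hMd := ih x' (dn F c) hnd hwd
    have hBd : |accExpQ F q x' n (fun t => t) (dn F c) - (dn F c + S')| ≤ n * (ε * g) :=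
      abs_accExpQ_id_sub_le F hq01 hq x' n (dn F c) hnd (hU.gapLE x' n _ hwd)
    obtain ⟨hp0, hp1⟩ := pUpQ_mem F hq01 c
    have hβ := abs_stepQ_id_sub_le F hq c
    rw [hcl] at hβ
    have hE2 := stepQ_sq_le F hq hin
    simp only [stepQ] at hβ hE2 ⊢
    rw [accExpQ_sq_split F q x' n (up F c) S' c, accExpQ_sq_split F q x' n (dn F c) S' c]
    rcases hU.roundUp_eq_or h1 h2 with hw0 | hwg
    · have e : roundDown F c = c := eq_of_roundUp_eq_roundDown hw0
      have hu : up F c = c := by unfold up; rw [hcl, hw0, e]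
      have hd : dn F c = c := by unfold dn; rw [hcl, e]
      rw [hd] at hMd; rw [hu, hd]
      have key : ∀ p m b : K,
          p * (m + 2 * (c - c) * b + (c - c) ^ 2) + (1 - p) * (m + 2 * (c - c) * b + (c - c) ^ 2) = m := by
        intro p m b; ring
      rw [key]; exact hMd.trans hmono
    · have hug : up F c = dn F c + g := by unfold up dn; rw [hcl]; exact hwg
      have hsh := hU.accExpQ_shift hlo q x' n (fun t => t) (dn F c) hnd hwd (by rw [← hug]; exact hnu)
        (by rw [← hug]; exact hwu)
      have hBu : accExpQ F q x' n (fun t => t) (up F c) - (up F c + S')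
          = accExpQ F q x' n (fun t => t) (dn F c) - (dn F c + S') := by
        rw [hug, hsh, accExpQ_id_add]; ring
      rw [hBu]
      have hgap : up F c - dn F c = g := by rw [hug]; ring
      rw [hgap] at hβ hE2
      set π := pUpQ F q c
      set u := up F c
      set d := dn F c
      set b := accExpQ F q x' n (fun t => t) d - (d + S')
      set Mu := accExpQ F q x' n (fun y => (y - (u + S')) ^ 2) u
      set Md := accExpQ F q x' n (fun y => (y - (d + S')) ^ 2) d
      clear_value π u d b Mu Md c x' S'
      have hT1 : π * Mu + (1 - π) * Md ≤ n * (g ^ 2 / 4) + (n * (ε * g)) ^ 2 := by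
        have a1 := mul_le_mul_of_nonneg_left hMu hp0
        have a2 := mul_le_mul_of_nonneg_left hMd (sub_nonneg.mpr hp1)
        linarith
      have hT2 : b * (π * u + (1 - π) * d - c) ≤ (n * (ε * g)) * (ε * g) :=
        calc b * (π * u + (1 - π) * d - c) ≤ |b * (π * u + (1 - π) * d - c)| := le_abs_self _
          _ = |b| * |π * u + (1 - π) * d - c| := abs_mul _ _
          _ ≤ (n * (ε * g)) * (ε * g) := mul_le_mul hBd hβ (abs_nonneg _) hnεg
      have hexp : π * (Mu + 2 * (u - c) * b + (u - c) ^ 2) + (1 - π) * (Md + 2 * (d - c) * b + (d - c) ^ 2)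
          = (π * Mu + (1 - π) * Md) + 2 * (b * (π * u + (1 - π) * d - c))
            + (π * (u - c) ^ 2 + (1 - π) * (d - c) ^ 2) := by ring
      rw [hexp]; linarith [hT1, hT2, hE2, hfin]

/-- **Crossover**: bias term `≤` variance term iff `n·ε² ≤ 1/4` (`ε = 2^{-N}`: iff `n ≤ 4^{N−1}`). -/
theorem bias_sq_le_var_iff {n ε g : K} (hn : 0 < n) (hg : 0 < g) :
    (n * (ε * g)) ^ 2 ≤ n * (g ^ 2 / 4) ↔ n * ε ^ 2 ≤ 1 / 4 := by
  have hpos : 0 < n * g ^ 2 := by positivity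
  rw [show (n * (ε * g)) ^ 2 = (n * ε ^ 2) * (n * g ^ 2) by ring,
    show n * (g ^ 2 / 4) = (1 / 4) * (n * g ^ 2) by ring]
  exact ⟨fun h => le_of_mul_le_mul_right h hpos, fun h => mul_le_mul_of_nonneg_right h hpos.le⟩

end LimitedBits

/-- `SR_ε` of [XiaEtAl2022] (`q = qAway ε`, file LVIII): `E(ŝₙ − sₙ)² ≤ n·g²/4 + (n·ε·g)²`. -/
theorem srEps_acc_sq_le (F : Finset K) {ε : K} (hε : 0 ≤ ε) {lo hi g : K} (hU : LimitedBits.UniformWindow F lo hi g)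
    (hlo : 0 ≤ lo) : ∀ (x : ℕ → K) (n : ℕ) (s : K), NoSat F x n s → InWindow F lo hi x n s →
      LimitedBits.accExpQ F (qAway ε) x n (fun t => (t - (s + ∑ i ∈ range n, x i)) ^ 2) s
        ≤ n * (g ^ 2 / 4) + (n * (ε * g)) ^ 2 :=
  LimitedBits.accExpQ_sq_le_uniform F (qAway_mem hε) (qAway_dev hε) hU hlo

section P3109
variable [FloorRing K]

/-- **P3109 StochasticA, `N` random bits**: `E(ŝₙ − sₙ)² ≤ n·g²/4 + (n·2^{-N}·g)²`. -/
theorem stochasticA_acc_sq_le (F : Finset K) (N : ℕ) {lo hi g : K} (hU : LimitedBits.UniformWindow F lo hi g)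
    (hlo : 0 ≤ lo) : ∀ (x : ℕ → K) (n : ℕ) (s : K), NoSat F x n s → InWindow F lo hi x n s →
      LimitedBits.accExpQ F (LimitedBits.probAwayA N) x n (fun t => (t - (s + ∑ i ∈ range n, x i)) ^ 2) s
        ≤ n * (g ^ 2 / 4) + (n * (1 / 2 ^ N * g)) ^ 2 :=
  LimitedBits.accExpQ_sq_le_uniform F (LimitedBits.probAwayA_mem N) (fun η _ _ => LimitedBits.abs_probAwayA_sub_le N η) hU hlo

/-- **P3109 StochasticB, `N` random bits**: `E(ŝₙ − sₙ)² ≤ n·g²/4 + (n·2^{-(N+1)}·g)²`. -/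
theorem stochasticB_acc_sq_le (F : Finset K) (N : ℕ) {lo hi g : K} (hU : LimitedBits.UniformWindow F lo hi g)
    (hlo : 0 ≤ lo) : ∀ (x : ℕ → K) (n : ℕ) (s : K), NoSat F x n s → InWindow F lo hi x n s →
      LimitedBits.accExpQ F (LimitedBits.probAwayB N) x n (fun t => (t - (s + ∑ i ∈ range n, x i)) ^ 2) s
        ≤ n * (g ^ 2 / 4) + (n * (1 / 2 ^ (N + 1) * g)) ^ 2 :=
  LimitedBits.accExpQ_sq_le_uniform F (LimitedBits.probAwayB_mem N) (fun η _ _ => LimitedBits.abs_probAwayB_sub_le N η) hU hlo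

/-- **P3109 StochasticC, `N` random bits**: `E(ŝₙ − sₙ)² ≤ n·g²/4 + (n·2^{-(N+1)}·g)²`. -/
theorem stochasticC_acc_sq_le (F : Finset K) (N : ℕ) {lo hi g : K} (hU : LimitedBits.UniformWindow F lo hi g)
    (hlo : 0 ≤ lo) : ∀ (x : ℕ → K) (n : ℕ) (s : K), NoSat F x n s → InWindow F lo hi x n s →
      LimitedBits.accExpQ F (LimitedBits.probAwayC N) x n (fun t => (t - (s + ∑ i ∈ range n, x i)) ^ 2) s
        ≤ n * (g ^ 2 / 4) + (n * (1 / 2 ^ (N + 1) * g)) ^ 2 :=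
  LimitedBits.accExpQ_sq_le_uniform F (LimitedBits.probAwayC_mem N) (fun η _ _ => LimitedBits.abs_probAwayC_sub_le N η) hU hlo

end P3109

namespace FP4

/-- E2M1 is equally spaced with spacing `1/2` on `[0, 2]` (and with spacing `1` on `[2, 4]`). -/
theorem e2m1_uniform_0_2 : LimitedBits.UniformWindow e2m1 0 2 (1 / 2) :=
  ⟨by decide +kernel, by decide +kernel, by norm_num, by decide +kernel, by decide +kernel⟩

/-- **The envelope is attained**: E2M1, `SR_ε`, `ε = 1/4`, `ŝ₀ = 0`, summands `9/8, 1/8` (hypotheses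
of `srEps_acc_sq_le` with `e2m1_uniform_0_2` certified): `E(ŝ₂ − 5/4)² = 3/16 = 2(1/2)²/4 + (2·¼·½)²`. -/
theorem e2m1_mse_tight :
    NoSat e2m1 (seq3 (9 / 8) (1 / 8) (1 / 8)) 2 0 ∧ InWindow e2m1 0 2 (seq3 (9 / 8) (1 / 8) (1 / 8)) 2 0 ∧
      LimitedBits.accExpQ e2m1 (qAway (1 / 4)) (seq3 (9 / 8) (1 / 8) (1 / 8)) 2
          (fun t => (t - 5 / 4) ^ 2) 0 = 3 / 16 ∧
      (2 : ℚ) * ((1 / 2) ^ 2 / 4) + (2 * (1 / 4 * (1 / 2))) ^ 2 = 3 / 16 := by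
  refine ⟨?_, ?_, by decide +kernel, by norm_num⟩
  · rw [← noSatB_iff]; decide +kernel
  · rw [← inWindowB_iff]; decide +kernel

/-- **Failure across zero**: E2M1, `SR_ε`, `ε = 1/8`, `ŝ₀ = 0`, summands `−5/4, +5/4` (all values in
the equally spaced `[−2, 2]`, gap `1/2`, no saturation): `E(ŝ₂ − 0)² = 5/32 > 9/64 = 2(1/2)²/4 + (2εg)²`. -/
theorem e2m1_mse_cross_zero :
    NoSat e2m1 (seq3 (-5 / 4) (5 / 4) (5 / 4)) 2 0 ∧
      LimitedBits.accExpQ e2m1 (qAway (1 / 8)) (seq3 (-5 / 4) (5 / 4) (5 / 4)) 2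
          (fun t => (t - 0) ^ 2) 0 = 5 / 32 ∧
      (2 : ℚ) * ((1 / 2) ^ 2 / 4) + (2 * (1 / 8 * (1 / 2))) ^ 2 = 9 / 64 ∧ (9 : ℚ) / 64 < 5 / 32 := by
  refine ⟨?_, by decide +kernel, by norm_num, by norm_num⟩
  rw [← noSatB_iff]; decide +kernel

end FP4

end Summit.Ventures.CertifiedArithmetic.LowPrec.SR
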